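import Summits.ResolutionOfSingularities.ResolutionOfSingularities.Theorems.FrobeniusClosingSteerWords02Stubs

/-!
# Crux `Steer` (stmt-ResolutionOfSingularities-16345), line `switching-dichotomy` — WORDS 04: the R2 RE-CUT, the CHARACTERISTIC SPLIT
and their pure-logic compositions (HOIST of the registered skeleton r34 ff764575764c21bc, l.348–541 and l.552–628)

Holder res-L0-w41-lead-1 g5 on res-L0-w41-plan-1 RULING 47 (E1); see `…Words01Core` for the hoist protocol. The skeleton's r17 re-cut
and r19 characteristic split, bodies byte for byte (docstrings: `[cite: …]` / `[folklore]` tags on the CLOSED `def … : Prop` words are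
written «(ref. …)» / «(folklore)» — see the GATE NOTE of `…Words02Stubs`): `Sig.stub_core4EternalNonIsolatedRecut`, `R2FourRankOne`,
`R2High`, `R2FourRankOneTwo`, `R2FourRankOneOdd`, `fourRankOne_of_two_odd`, `two_odd_of_fourRankOne`, `R2OddHigh` (the TYPE of the
registered parked stub `stub_R2OddHigh`, which the skeleton keeps proving itself), and the compositions
`core4EternalNonIsolated_of_recut`, `recut_of_core4EternalNonIsolated`, `recut_of_split`, `split_of_core4EternalNonIsolated`,
`core4EternalNonIsolated_of_pieces`, `core4EternalNonIsolated_of_charPieces`, `core4EternalNonIsolated_of_two_oddHigh`,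
`oddHigh_of_core4EternalNonIsolated`, `fourRankOneTwo_of_core4EternalNonIsolated`. Imports `…Words02Stubs` (the `Sig.*` statements;
that module imports the route file, so this one sits in the same rebuild cone — unavoidable for words stated over `Sig.stub_core4EternalNonIsolated`).
Nothing here is a statement of the manuscript [claim: Hironaka2017, status: under-review]. OURS (candidates / vocabulary; AI review is
weaker than expert review).
-/

open Literature.AlgebraicGeometry.Resolution (IsAbhyankarPlace FGOver exists_ringKrullDim_eq_and_trdeg_eq
  trdeg_eq_trdeg_of_isFractionRing locAtCentre IsQuadraticTransformAlong SubringDominates IsRsopPart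
  LocalUniformization3 RelLocalUniformization CossartPiltant2019General)
open Summit.ResolutionOfSingularities.ResolutionOfSingularities.Theorems.SteerRankThinness
  (HasProperCoarsening concl_of_hasProperCoarsening rankOne_of_not_hasProperCoarsening)

set_option linter.dupNamespace false

namespace Summit.ResolutionOfSingularities.ResolutionOfSingularities.Theorems.SwitchingDichotomy.Words

/-! ### r17 — THE R2 RE-CUT (plan-1 g7's `Sketch-R2-recut.lean` fc3184e97514f93e §4 VERBATIM): R2 ⇔ (n = 4 → rank one)-recut
modulo the fact debt; recut = `R2FourRankOne` (n = 4, rank one: THE LIVE R2 RESIDUAL) ∧ `R2High` (n ≥ 5, parked) -/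

/-- **R2 re-cut** (CHAIN v5.4 §B2): R2 with the ONE extra binder `(n = 4 → ¬ HasProperCoarsening O)` inserted after the
transcendence-degree binder — at `n = 4` the valuation ring has NO proper coarsening (rank one,
`SteerRankThinness.rankOne_of_not_hasProperCoarsening`). DERIVED r17 form of the registered R2 stub (`stub_core4EternalNonIsolated` below is a theorem of the two pieces + the fact). FRONTIER.
(ref. HeinzerEtAl2015, Discussion 4.2) (ref. CossartPiltant2019, Thm. 1.1) -/
def Sig.stub_core4EternalNonIsolatedRecut : Prop :=
  ∀ p : ℕ, p.Prime → ∀ n : ℕ, 4 ≤ n → TorsorLUZeroDimBelow p n →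
    ∀ (k K : Type) [Field k] [CharP k p] [PerfectField k] [Field K] [Algebra k K]
    (O : ValuationSubring K) (A₀ : Subalgebra k K) (h₀ : A₀.toSubring ≤ O.toSubring) (t : K),
    A₀.FG → ∀ (htp : t ^ p ∈ A₀), IsFractionRing (Algebra.adjoin k (insert t (A₀ : Set K))) K →
    IsRegularLocalRing (Localization.AtPrime
      (Ideal.comap (Subring.inclusion h₀) (IsLocalRing.maximalIdeal O))) →
    (Ideal.comap (Subring.inclusion h₀) (IsLocalRing.maximalIdeal O)).IsMaximal →
    ZeroDim k O →
    ¬ ringKrullDim (Localization.AtPrime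
      (Ideal.comap (Subring.inclusion h₀) (IsLocalRing.maximalIdeal O))) ≤ 2 →
    ¬ IsAbhyankarPlace O (algebraMap k K).fieldRange ⊤ →
    ¬ DenseAbhyankar k O →
    ¬ Discrete O →
    (∀ δ : Derivation ℤ (Localization.AtPrime (Ideal.comap (Subring.inclusion h₀)
        (IsLocalRing.maximalIdeal O))) (Localization.AtPrime (Ideal.comap (Subring.inclusion h₀)
        (IsLocalRing.maximalIdeal O))),
      ¬ IsUnit (δ (algebraMap A₀.toSubring (Localization.AtPrime (Ideal.comap (Subring.inclusion h₀)
        (IsLocalRing.maximalIdeal O))) ⟨t ^ p, htp⟩))) →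
    (∀ c : Localization.AtPrime (Ideal.comap (Subring.inclusion h₀) (IsLocalRing.maximalIdeal O)),
      algebraMap A₀.toSubring (Localization.AtPrime (Ideal.comap (Subring.inclusion h₀)
        (IsLocalRing.maximalIdeal O))) ⟨t ^ p, htp⟩ ≠ c ^ p) →
    Algebra.trdeg k K = (n : Cardinal) →
    (n = 4 → ¬ HasProperCoarsening O) →
    ¬ (StronglySwitching O A₀ ∧ ArchSeq O A₀ ∧ ¬ Defect O A₀ t p) →
    ∀ R : ℕ → Subring K, R 0 = locAtCentre A₀.toSubring O →
      (∀ i, IsQuadraticTransformAlong O (R i) (R (i + 1))) →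
      ∀ s : ℕ → K, IsTorsorRun O R t p s → (∀ i₀ : ℕ, ∃ i, i₀ ≤ i ∧ ¬ IsolAt O (R i) (s i ^ p)) →
        Concl O A₀ t

/-- **R2 at n = 4 in RANK ONE** — THE LIVE RESIDUAL of W4.1's R2 (CHAIN v5.4 §B2; cut once more by characteristic in §6): `p` prime, transcendence degree
exactly `4`, no proper coarsening, every other binder of R2 verbatim. No inhabitant of ESSENTIAL DIMENSION 4 is on
record (K4.1c's `W₂′` is rank two; K4.1b / `W_far` / tri-2's / K4.1c's radicands are cylinders). FRONTIER.
(ref. HeinzerEtAl2015, Discussion 4.2) (ref. arXiv:1802.05010, §3) -/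
def R2FourRankOne : Prop :=
  ∀ p : ℕ, p.Prime → TorsorLUZeroDimBelow p 4 →
    ∀ (k K : Type) [Field k] [CharP k p] [PerfectField k] [Field K] [Algebra k K]
    (O : ValuationSubring K) (A₀ : Subalgebra k K) (h₀ : A₀.toSubring ≤ O.toSubring) (t : K),
    A₀.FG → ∀ (htp : t ^ p ∈ A₀), IsFractionRing (Algebra.adjoin k (insert t (A₀ : Set K))) K →
    IsRegularLocalRing (Localization.AtPrime
      (Ideal.comap (Subring.inclusion h₀) (IsLocalRing.maximalIdeal O))) →
    (Ideal.comap (Subring.inclusion h₀) (IsLocalRing.maximalIdeal O)).IsMaximal →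
    ZeroDim k O →
    ¬ ringKrullDim (Localization.AtPrime
      (Ideal.comap (Subring.inclusion h₀) (IsLocalRing.maximalIdeal O))) ≤ 2 →
    ¬ IsAbhyankarPlace O (algebraMap k K).fieldRange ⊤ →
    ¬ DenseAbhyankar k O →
    ¬ Discrete O →
    (∀ δ : Derivation ℤ (Localization.AtPrime (Ideal.comap (Subring.inclusion h₀)
        (IsLocalRing.maximalIdeal O))) (Localization.AtPrime (Ideal.comap (Subring.inclusion h₀)
        (IsLocalRing.maximalIdeal O))),
      ¬ IsUnit (δ (algebraMap A₀.toSubring (Localization.AtPrime (Ideal.comap (Subring.inclusion h₀)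
        (IsLocalRing.maximalIdeal O))) ⟨t ^ p, htp⟩))) →
    (∀ c : Localization.AtPrime (Ideal.comap (Subring.inclusion h₀) (IsLocalRing.maximalIdeal O)),
      algebraMap A₀.toSubring (Localization.AtPrime (Ideal.comap (Subring.inclusion h₀)
        (IsLocalRing.maximalIdeal O))) ⟨t ^ p, htp⟩ ≠ c ^ p) →
    Algebra.trdeg k K = ((4 : ℕ) : Cardinal) →
    ¬ HasProperCoarsening O →
    ¬ (StronglySwitching O A₀ ∧ ArchSeq O A₀ ∧ ¬ Defect O A₀ t p) →
    ∀ R : ℕ → Subring K, R 0 = locAtCentre A₀.toSubring O →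
      (∀ i, IsQuadraticTransformAlong O (R i) (R (i + 1))) →
      ∀ s : ℕ → K, IsTorsorRun O R t p s → (∀ i₀ : ℕ, ∃ i, i₀ ≤ i ∧ ¬ IsolAt O (R i) (s i ^ p)) →
        Concl O A₀ t

/-- **R2 in transcendence degree `≥ 5`** — R2 verbatim with `4 < n`; UNCOVERED by any landed range and PARKED (CHAIN
v5.4 §B2: at `n ≥ 5` the composite-rank discharge would need local uniformization of ALL quasi-excellent local rings
of dimension `≤ n - 1`, not in print). FRONTIER. (ref. HeinzerEtAl2015, Discussion 4.2) -/
def R2High : Prop :=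
  ∀ p : ℕ, p.Prime → ∀ n : ℕ, 4 < n → TorsorLUZeroDimBelow p n →
    ∀ (k K : Type) [Field k] [CharP k p] [PerfectField k] [Field K] [Algebra k K]
    (O : ValuationSubring K) (A₀ : Subalgebra k K) (h₀ : A₀.toSubring ≤ O.toSubring) (t : K),
    A₀.FG → ∀ (htp : t ^ p ∈ A₀), IsFractionRing (Algebra.adjoin k (insert t (A₀ : Set K))) K →
    IsRegularLocalRing (Localization.AtPrime
      (Ideal.comap (Subring.inclusion h₀) (IsLocalRing.maximalIdeal O))) →
    (Ideal.comap (Subring.inclusion h₀) (IsLocalRing.maximalIdeal O)).IsMaximal →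
    ZeroDim k O →
    ¬ ringKrullDim (Localization.AtPrime
      (Ideal.comap (Subring.inclusion h₀) (IsLocalRing.maximalIdeal O))) ≤ 2 →
    ¬ IsAbhyankarPlace O (algebraMap k K).fieldRange ⊤ →
    ¬ DenseAbhyankar k O →
    ¬ Discrete O →
    (∀ δ : Derivation ℤ (Localization.AtPrime (Ideal.comap (Subring.inclusion h₀)
        (IsLocalRing.maximalIdeal O))) (Localization.AtPrime (Ideal.comap (Subring.inclusion h₀)
        (IsLocalRing.maximalIdeal O))),
      ¬ IsUnit (δ (algebraMap A₀.toSubring (Localization.AtPrime (Ideal.comap (Subring.inclusion h₀)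
        (IsLocalRing.maximalIdeal O))) ⟨t ^ p, htp⟩))) →
    (∀ c : Localization.AtPrime (Ideal.comap (Subring.inclusion h₀) (IsLocalRing.maximalIdeal O)),
      algebraMap A₀.toSubring (Localization.AtPrime (Ideal.comap (Subring.inclusion h₀)
        (IsLocalRing.maximalIdeal O))) ⟨t ^ p, htp⟩ ≠ c ^ p) →
    Algebra.trdeg k K = (n : Cardinal) →
    ¬ (StronglySwitching O A₀ ∧ ArchSeq O A₀ ∧ ¬ Defect O A₀ t p) →
    ∀ R : ℕ → Subring K, R 0 = locAtCentre A₀.toSubring O →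
      (∀ i, IsQuadraticTransformAlong O (R i) (R (i + 1))) →
      ∀ s : ℕ → K, IsTorsorRun O R t p s → (∀ i₀ : ℕ, ∃ i, i₀ ≤ i ∧ ¬ IsolAt O (R i) (s i ^ p)) →
        Concl O A₀ t

/-! ### r19 — CHARACTERISTIC SPLIT of the live R2 residual (plan-1 g7's `Sketch-R2-recut.lean` v2 42fceeb46e145bfe §6
VERBATIM, CHAIN v5.4a; WORD 04:57:11Z): `R2FourRankOne` = `R2FourRankOneTwo` (p = 2: the σ-steered composition's target —
X `SteeredExit` p497302 + E `SteeredRunExists` + the empty steered stall at p = 2 + the σ-residuals, to be DERIVED at the next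
boundary) ∧ `R2FourRankOneOdd` (odd p: unified-machine design target); the odd piece and `R2High` are PARKED together as ONE
registered name `stub_R2OddHigh`. -/

section CharSplit

/-- **R2 at n = 4, rank one, p = 2** — the target a σ-steered composition can conclude BY NAME under r15 without a
cycle (stall oracle = the landed `LowMult.core4LowMult_two`; steered stalls are expected to be EMPTY at `p = 2`).
Stated with a bound `p` and the binder `p = 2` so that every other binder is R2-verbatim. FRONTIER (no admissible
inhabitant of its hypotheses known — PREREG K4.1f). (ref. HeinzerEtAl2015, Discussion 4.2) -/
def R2FourRankOneTwo : Prop :=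
  ∀ p : ℕ, p = 2 → TorsorLUZeroDimBelow p 4 →
    ∀ (k K : Type) [Field k] [CharP k p] [PerfectField k] [Field K] [Algebra k K]
    (O : ValuationSubring K) (A₀ : Subalgebra k K) (h₀ : A₀.toSubring ≤ O.toSubring) (t : K),
    A₀.FG → ∀ (htp : t ^ p ∈ A₀), IsFractionRing (Algebra.adjoin k (insert t (A₀ : Set K))) K →
    IsRegularLocalRing (Localization.AtPrime
      (Ideal.comap (Subring.inclusion h₀) (IsLocalRing.maximalIdeal O))) →
    (Ideal.comap (Subring.inclusion h₀) (IsLocalRing.maximalIdeal O)).IsMaximal →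
    ZeroDim k O →
    ¬ ringKrullDim (Localization.AtPrime
      (Ideal.comap (Subring.inclusion h₀) (IsLocalRing.maximalIdeal O))) ≤ 2 →
    ¬ IsAbhyankarPlace O (algebraMap k K).fieldRange ⊤ →
    ¬ DenseAbhyankar k O →
    ¬ Discrete O →
    (∀ δ : Derivation ℤ (Localization.AtPrime (Ideal.comap (Subring.inclusion h₀)
        (IsLocalRing.maximalIdeal O))) (Localization.AtPrime (Ideal.comap (Subring.inclusion h₀)
        (IsLocalRing.maximalIdeal O))),
      ¬ IsUnit (δ (algebraMap A₀.toSubring (Localization.AtPrime (Ideal.comap (Subring.inclusion h₀)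
        (IsLocalRing.maximalIdeal O))) ⟨t ^ p, htp⟩))) →
    (∀ c : Localization.AtPrime (Ideal.comap (Subring.inclusion h₀) (IsLocalRing.maximalIdeal O)),
      algebraMap A₀.toSubring (Localization.AtPrime (Ideal.comap (Subring.inclusion h₀)
        (IsLocalRing.maximalIdeal O))) ⟨t ^ p, htp⟩ ≠ c ^ p) →
    Algebra.trdeg k K = ((4 : ℕ) : Cardinal) →
    ¬ HasProperCoarsening O →
    ¬ (StronglySwitching O A₀ ∧ ArchSeq O A₀ ∧ ¬ Defect O A₀ t p) →
    ∀ R : ℕ → Subring K, R 0 = locAtCentre A₀.toSubring O →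
      (∀ i, IsQuadraticTransformAlong O (R i) (R (i + 1))) →
      ∀ s : ℕ → K, IsTorsorRun O R t p s → (∀ i₀ : ℕ, ∃ i, i₀ ≤ i ∧ ¬ IsolAt O (R i) (s i ^ p)) →
        Concl O A₀ t

/-- **R2 at n = 4, rank one, p odd** — design target of the UNIFIED MACHINE (oracle-free stall re-base + one frontier
alternation residual; CHAIN v5.4a). FRONTIER. (ref. HeinzerEtAl2015, Discussion 4.2) (ref. arXiv:1802.05010, §3) -/
def R2FourRankOneOdd : Prop :=
  ∀ p : ℕ, p.Prime → p ≠ 2 → TorsorLUZeroDimBelow p 4 →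
    ∀ (k K : Type) [Field k] [CharP k p] [PerfectField k] [Field K] [Algebra k K]
    (O : ValuationSubring K) (A₀ : Subalgebra k K) (h₀ : A₀.toSubring ≤ O.toSubring) (t : K),
    A₀.FG → ∀ (htp : t ^ p ∈ A₀), IsFractionRing (Algebra.adjoin k (insert t (A₀ : Set K))) K →
    IsRegularLocalRing (Localization.AtPrime
      (Ideal.comap (Subring.inclusion h₀) (IsLocalRing.maximalIdeal O))) →
    (Ideal.comap (Subring.inclusion h₀) (IsLocalRing.maximalIdeal O)).IsMaximal →
    ZeroDim k O →
    ¬ ringKrullDim (Localization.AtPrime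
      (Ideal.comap (Subring.inclusion h₀) (IsLocalRing.maximalIdeal O))) ≤ 2 →
    ¬ IsAbhyankarPlace O (algebraMap k K).fieldRange ⊤ →
    ¬ DenseAbhyankar k O →
    ¬ Discrete O →
    (∀ δ : Derivation ℤ (Localization.AtPrime (Ideal.comap (Subring.inclusion h₀)
        (IsLocalRing.maximalIdeal O))) (Localization.AtPrime (Ideal.comap (Subring.inclusion h₀)
        (IsLocalRing.maximalIdeal O))),
      ¬ IsUnit (δ (algebraMap A₀.toSubring (Localization.AtPrime (Ideal.comap (Subring.inclusion h₀)
        (IsLocalRing.maximalIdeal O))) ⟨t ^ p, htp⟩))) →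
    (∀ c : Localization.AtPrime (Ideal.comap (Subring.inclusion h₀) (IsLocalRing.maximalIdeal O)),
      algebraMap A₀.toSubring (Localization.AtPrime (Ideal.comap (Subring.inclusion h₀)
        (IsLocalRing.maximalIdeal O))) ⟨t ^ p, htp⟩ ≠ c ^ p) →
    Algebra.trdeg k K = ((4 : ℕ) : Cardinal) →
    ¬ HasProperCoarsening O →
    ¬ (StronglySwitching O A₀ ∧ ArchSeq O A₀ ∧ ¬ Defect O A₀ t p) →
    ∀ R : ℕ → Subring K, R 0 = locAtCentre A₀.toSubring O →
      (∀ i, IsQuadraticTransformAlong O (R i) (R (i + 1))) →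
      ∀ s : ℕ → K, IsTorsorRun O R t p s → (∀ i₀ : ℕ, ∃ i, i₀ ≤ i ∧ ¬ IsolAt O (R i) (s i ^ p)) →
        Concl O A₀ t

/-- The characteristic split re-assembles the live residual. Pure logic. [folklore] -/
theorem fourRankOne_of_two_odd (h2 : R2FourRankOneTwo) (hodd : R2FourRankOneOdd) : R2FourRankOne := by
  intro p hp hB
  by_cases hp2 : p = 2
  · exact h2 p hp2 hB
  · exact hodd p hp hp2 hB

/-- … and loses nothing. Pure logic. [folklore] -/
theorem two_odd_of_fourRankOne (h : R2FourRankOne) : R2FourRankOneTwo ∧ R2FourRankOneOdd :=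
  ⟨fun p hp2 hB => h p (hp2 ▸ Nat.prime_two) hB, fun p hp _ hB => h p hp hB⟩

end CharSplit

/-- **R2OddHigh** (r19; ONE parked registered name, plan-1 WORD 04:57:11Z (2)): the odd-characteristic rank-one residual at
`n = 4` together with the transcendence-degree-`≥ 5` residual. FRONTIER, PARKED. -/
def R2OddHigh : Prop :=
  R2FourRankOneOdd ∧ R2High

section Compositions

open Summit.ResolutionOfSingularities.ResolutionOfSingularities.Theorems.SteerRankThinness
  (concl_of_hasProperCoarsening)

/-- **(γ₄) composition, kernel-checked**: the single fact debt and the re-cut give the registered R2 VERBATIM. At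
`n = 4` with a proper coarsening, idea-1's landed `concl_of_hasProperCoarsening` (p493665) concludes from the four
cheap binders; otherwise the re-cut applies. Pure logic over the tree. [folklore] -/
theorem core4EternalNonIsolated_of_recut (hCP : Sig.stub_cp2019General)
    (h : Sig.stub_core4EternalNonIsolatedRecut) : Sig.stub_core4EternalNonIsolated := by
  intro p hp n hn hB k K _ _ _ _ _ O A₀ h₀ t hfg htp hfr hreg hmax hZ hdim hAbh hDA hD hδ hc htr hcore R hR0 hRq
    s hs hni
  by_cases hγ : n = 4 ∧ HasProperCoarsening O
  · obtain ⟨rfl, hO⟩ := hγ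
    have h4 : Algebra.trdeg k K ≤ 4 := by rw [htr]; norm_num
    exact concl_of_hasProperCoarsening hCP p hp.ne_zero h4 O hO A₀ h₀ t hfg htp hfr
  · exact h p hp n hn hB k K O A₀ h₀ t hfg htp hfr hreg hmax hZ hdim hAbh hDA hD hδ hc htr
      (fun h4 hO => hγ ⟨h4, hO⟩) hcore R hR0 hRq s hs hni

/-- Converse (honesty: the re-cut is the registered R2 minus a case, never stronger). Pure logic. [folklore] -/
theorem recut_of_core4EternalNonIsolated (h : Sig.stub_core4EternalNonIsolated) :
    Sig.stub_core4EternalNonIsolatedRecut := by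
  intro p hp n hn hB k K _ _ _ _ _ O A₀ h₀ t hfg htp hfr hreg hmax hZ hdim hAbh hDA hD hδ hc htr _ hcore R hR0 hRq
    s hs hni
  exact h p hp n hn hB k K O A₀ h₀ t hfg htp hfr hreg hmax hZ hdim hAbh hDA hD hδ hc htr hcore R hR0 hRq s hs hni

/-- **Dimension split of the re-cut, kernel-checked**: `R2FourRankOne` and `R2High` give the re-cut. Pure logic.
[folklore] -/
theorem recut_of_split (h4 : R2FourRankOne) (h5 : R2High) : Sig.stub_core4EternalNonIsolatedRecut := by
  intro p hp n hn hB k K _ _ _ _ _ O A₀ h₀ t hfg htp hfr hreg hmax hZ hdim hAbh hDA hD hδ hc htr hγ hcore R hR0 hRq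
    s hs hni
  rcases Nat.eq_or_lt_of_le hn with h | h
  · subst h
    exact h4 p hp hB k K O A₀ h₀ t hfg htp hfr hreg hmax hZ hdim hAbh hDA hD hδ hc htr (hγ rfl) hcore R hR0 hRq
      s hs hni
  · exact h5 p hp n h hB k K O A₀ h₀ t hfg htp hfr hreg hmax hZ hdim hAbh hDA hD hδ hc htr hcore R hR0 hRq s hs hni

/-- The two pieces are each implied by the registered R2 (so the split loses nothing and adds nothing false).
Pure logic. [folklore] -/
theorem split_of_core4EternalNonIsolated (h : Sig.stub_core4EternalNonIsolated) : R2FourRankOne ∧ R2High := by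
  refine ⟨?_, ?_⟩
  · intro p hp hB k K _ _ _ _ _ O A₀ h₀ t hfg htp hfr hreg hmax hZ hdim hAbh hDA hD hδ hc htr _ hcore R hR0 hRq
      s hs hni
    exact h p hp 4 le_rfl hB k K O A₀ h₀ t hfg htp hfr hreg hmax hZ hdim hAbh hDA hD hδ hc htr hcore R hR0 hRq
      s hs hni
  · intro p hp n hn hB k K _ _ _ _ _ O A₀ h₀ t hfg htp hfr hreg hmax hZ hdim hAbh hDA hD hδ hc htr hcore R hR0 hRq
      s hs hni
    exact h p hp n hn.le hB k K O A₀ h₀ t hfg htp hfr hreg hmax hZ hdim hAbh hDA hD hδ hc htr hcore R hR0 hRq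
      s hs hni

/-- **r14 proposal in one line**: ONE fact debt + the two dimension pieces give the registered R2. [folklore] -/
theorem core4EternalNonIsolated_of_pieces (hCP : Sig.stub_cp2019General) (h4 : R2FourRankOne) (h5 : R2High) :
    Sig.stub_core4EternalNonIsolated :=
  core4EternalNonIsolated_of_recut hCP (recut_of_split h4 h5)

end Compositions

/-- **Characteristic-split assembly (recut v2 §6)**: ONE fact debt + `p = 2` piece + odd piece + `n ≥ 5`
piece give the registered R2. [folklore] -/
theorem core4EternalNonIsolated_of_charPieces (hCP : Sig.stub_cp2019General) (h2 : R2FourRankOneTwo)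
    (hodd : R2FourRankOneOdd) (h5 : R2High) : Sig.stub_core4EternalNonIsolated :=
  core4EternalNonIsolated_of_pieces hCP (fourRankOne_of_two_odd h2 hodd) h5

/-- **ONE fact debt + the `p = 2` piece + the parked name give the registered R2** (plan-1 g7's snippet
`R2CharSplit-r18.snippet.lean`, verbatim). Pure logic. [folklore] -/
theorem core4EternalNonIsolated_of_two_oddHigh (hCP : Sig.stub_cp2019General) (h2 : R2FourRankOneTwo)
    (hOH : R2OddHigh) : Sig.stub_core4EternalNonIsolated :=
  core4EternalNonIsolated_of_charPieces hCP h2 hOH.1 hOH.2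

/-- Honesty: the parked name is implied by the registered R2 (nothing stronger is parked). Pure logic. [folklore] -/
theorem oddHigh_of_core4EternalNonIsolated (h : Sig.stub_core4EternalNonIsolated) : R2OddHigh :=
  ⟨(two_odd_of_fourRankOne (split_of_core4EternalNonIsolated h).1).2, (split_of_core4EternalNonIsolated h).2⟩

/-- Honesty: the `p = 2` piece is implied by the registered R2. Pure logic. [folklore] -/
theorem fourRankOneTwo_of_core4EternalNonIsolated (h : Sig.stub_core4EternalNonIsolated) : R2FourRankOneTwo :=
  (two_odd_of_fourRankOne (split_of_core4EternalNonIsolated h).1).1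


end Summit.ResolutionOfSingularities.ResolutionOfSingularities.Theorems.SwitchingDichotomy.Words
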